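import Summits.HodgeConjecture.HodgeConjecture.Theses.AmpleAdicLefschetz
import Summits.HodgeConjecture.HodgeConjecture.Theorems.AmpleAdicLefschetzSectionalSourceStubSupply
import Summits.HodgeConjecture.HodgeConjecture.Theorems.AmpleAdicLefschetzSectionalSourceStubLowDegree
import Summits.HodgeConjecture.HodgeConjecture.Theorems.AmpleAdicLefschetzSectionalSourceStubIteratedSupply
import Literature.AlgebraicGeometry.HodgeTheory.HodgeTypePullback
import Literature.AlgebraicGeometry.HodgeTheory.ComplexConjugationHolds
import Literature.AlgebraicGeometry.HodgeTheory.VanishingCohomologyNontrivialProofs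
import HarnessLib

/-!
# Line `birth` (slug `registered`) — skeleton for the crux `SectionalSource` (stmt-HodgeConjecture-10725)

Route `AmpleAdicLefschetz` (route-HodgeConjecture-AmpleAdicLefschetz), crux #3 `SectionalSource` (SS,
rev-3 proper-section form): for `X` smooth projective of dimension `n` over `ℂ`, `2p + 1 ≤ n`, and `c` a
rational `(p,p)`-class in `H²ᵖ(X(ℂ); ℂ)`, there is an ADMISSIBLE PROPER SECTION `(m, Y, f, s)` — `Y` smooth
projective of dimension `m`, `f : Y ⟶ X` a closed immersion, `s` a finite set of affine opens of `X`
covering exactly `X ∖ f(Y)`, `2p + |s| ≤ n`, `X ∖ f(Y) ≠ ∅` — with `f^* c ∈ algebraicClasses Y p`.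

## RESHAPE 3 (line lead `prover-line-stmt-HodgeConjecture-10725-0`, 2026-08-17, cycle 2): SS ≡ MIDDLE-DEGREE HC

The lead's hardness theorem (`Cruxes/SectionalSource/Hardness.lean`, sorry-free: `SectionalSource →` the
Hodge conjecture in the middle degree `2p` of EVERY smooth projective `2p`-fold, via `X₀ × ℙ¹`, dominance of
one-affine-complement sections and the degree trick `g_* g^* = deg • id`) says the crux CONTAINS middle-degree
HC. This skeleton proves the CONVERSE composition, so that the crux is EQUIVALENT to middle-degree HC and
its single open stub is that classical statement:

* `stub_supply` — BERTINI SUPPLY (one smooth hyperplane section with ONE affine complement). LANDED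
  (`Theorems/AmpleAdicLefschetzSectionalSourceStubSupply.lean`, p149456).
* `stub_lowDegree` — SUPPLY ⇒ SS on `p ≤ 1 ∨ n ≤ 4` (Lefschetz (1,1) / HC in dimension ≤ 3 ON the supplied
  section). LANDED (`Theorems/AmpleAdicLefschetzSectionalSourceStubLowDegree.lean`, p150627).
* `stub_iteratedSupply` — ITERATED BERTINI SUPPLY. LANDED (`Theorems/AmpleAdicLefschetzSectionalSourceStubIteratedSupply.lean`,
  p153594): for `X` smooth projective of
  dimension `n` and `1 ≤ k ≤ n − 1` there is a smooth projective closed `Y ⊂ X` of dimension `n − k` (a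
  smooth complete intersection of `k` hyperplane sections `X ∩ V(ℓ₁) ∩ ⋯ ∩ V(ℓ_k)` FROM ONE EMBEDDING,
  by `stub_supply`'s pencil step iterated along `Y_{i} ↪ X ↪ ℙᴺ`) whose non-empty complement is covered by
  `≤ k` AFFINE opens of `X` — namely the basic opens `X ∩ D(ℓ_i)`:
  `X ∖ (V(ℓ₁) ∩ ⋯ ∩ V(ℓ_k)) = ⋃ᵢ X ∩ D(ℓᵢ)`. (This answers the registrar's objection to the
  critical-dimension cut — "extending affine opens of a section to affine opens of `X` is not formal":
  with hyperplane sections of the SAME ambient embedding the affine opens are ambient basic opens.)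
  [Hartshorne II Thm. 8.18, II Prop. 2.5; Voisin II §2.1.1]
* `stub_hodgeMiddle` — THE HODGE CONJECTURE IN THE MIDDLE DEGREE, `p ≥ 2`: every rational `(p,p)`-class
  on every smooth projective complex variety of dimension `2p` is algebraic. THE OPEN STUB (open-problem
  grade; its first instance `p = 2` is HC for fourfolds in degree 4). By `Hardness.lean` it is IMPLIED by
  the crux, so it is exactly crux-sized — the honest residue of SS.
* `SectionalSource_of : supply-sig → lowDegree-sig → iteratedSupply-sig → hodgeMiddle-sig → SectionalSource`
  (sorry-free): for `p ≤ 1` the low-degree calibration; for `p ≥ 2` cut `X` by `k = n − 2p` hyperplane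
  sections to a smooth `Y` of dimension EXACTLY `2p` with `≤ n − 2p` affine complement pieces
  (`stub_iteratedSupply`), note `f^* c` is a rational `(p,p)`-class on `Y` (`IsRationalClass.map`,
  `IsOfHodgeType.map_of_le`) in the MIDDLE degree of `Y`, and apply `stub_hodgeMiddle` on `Y`.
* `SectionalSource_of_stubs : SectionalSource` — the crux BY NAME from the four declared stubs.

History of the line: reshape 1 (wave 1) landed `stub_supply`, added and landed `stub_lowDegree`, confined
SPAN to `p ≥ 2`; the saturation composition (`Submodule.span_induction` over sectionally algebraic
generators, with `stub_spanHigh` + `stub_directed`) is retired by this reshape: `stub_directed` was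
`stub-blocked: ThickDescent` (worker verdict; its reduction `ThickDescent → Fulton → Directed` is recorded in
the previous revision of this file, commit 89802ba9e20e) and `stub_spanHigh ⊇ stub_hodgeMiddle` by
`Hardness.lean`; the new cut needs NEITHER directedness NOR `ThickDescent` and leaves one classical stub.

`sorry` occurs ONLY in `stub_hodgeMiddle` — the Hodge conjecture in the middle degree (`p ≥ 2`), to which the crux is
EQUIVALENT (`Cruxes/SectionalSource/Hardness.lean`: `sectionalSource_iff_hodgeMiddle`).

## UPDATE (continuation lead `prover-line-stmt-HodgeConjecture-10725-c1-0`, 2026-08-17, cycle 1): THE OPEN STUB ≡ THE SUMMIT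

No reshape of the composition (stubs and `SectionalSource_of` byte-identical to reshape 3). What is new is LANDED (import it to use
it): `Theorems/AmpleAdicLefschetzSectionalSourceIffHodgeConjecture.lean` (p155811, sorry-free, standard
axioms) proves `ampleAdicLefschetz_sectionalSource_iff_hodgeConjecture : SectionalSource ↔ _root_.HodgeConjecture`
(SS ⇒ middle-degree HC by `mem_algebraicClasses_middle_of_affineComplSections`; ⇒ HC by BFNP Lemma 48
`hodgeConjectureFor_of_middleDimension_holds`; HC ⇒ SS by this composition) and
`ampleAdicLefschetz_stubHodgeMiddle_iff_hodgeConjecture` (the signature of `stub_hodgeMiddle` ↔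
`_root_.HodgeConjecture`). So the single `sorry` below is SUMMIT-sized: no line for this crux can
close it short of proving the Hodge conjecture, and in the route's `closes` every hypothesis but SS is idle
(`ampleAdicLefschetz_closes_of_sectionalSource_only`). Wave: none (1 stub open, held by the lead).

## Disproof used

None exists (`ledger crux ls`: no `Disproof.lean`; payload without `disproof_path`). Negative knowledge
produced by the lead instead: `Hardness.lean` (`not_sectionalSource_of_middle_counterexample`: one
non-algebraic middle-degree Hodge class refutes the crux).

## References

* P. Deligne, *The Hodge conjecture*, Clay Mathematics Institute (2000), §1. [Deligne2000]
* C. Voisin, *Hodge Theory and Complex Algebraic Geometry I* (2002), Thm. 11.30, §7.3.2 Rem. 7.29. [VoisinHodgeI2002]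
* C. Voisin, *Hodge Theory and Complex Algebraic Geometry II* (2003), Thm. 1.23, §2.1.1. [VoisinHodgeII2003]
* R. Hartshorne, *Algebraic Geometry* (1977), II Prop. 2.5, II Thm. 8.18, III Cor. 7.9. [Hartshorne1977]
* P. Brosnan, H. Fang, Z. Nie, G. Pearlstein, *Singularities of admissible normal functions*, Invent. Math. 177 (2009), §6 Lemma 48. [BrosnanFangNiePearlstein2009]
-/

-- `Summit.<Summit>.<Problem>`: for the single-conjunct summit `HodgeConjecture` the duplicate component is mandated.
set_option linter.dupNamespace false
set_option linter.unusedVariables false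

noncomputable section

namespace Summit.HodgeConjecture.HodgeConjecture.Cruxes.SectionalSource.Birth

open CategoryTheory AlgebraicGeometry
open Literature.AlgebraicGeometry Literature.AlgebraicGeometry.Motives
open Literature.AlgebraicGeometry.HodgeTheory
open Summit.HodgeConjecture.HodgeConjecture.Theses.AmpleAdicLefschetz

/-! ## The objects of the line -/

/-- **Sectionally algebraic classes.** A class `c ∈ H²ᵖ(X(ℂ); ℂ)` on the `n`-fold `X` is SECTIONALLY
ALGEBRAIC if there is an admissible proper section of ample type — `Y` smooth projective of some dimension
`m`, a closed immersion `f : Y ⟶ X`, a finite set `s` of affine opens of `X` covering exactly `X ∖ f(Y)` with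
`2p + |s| ≤ n`, and `X ∖ f(Y) ≠ ∅` — on which `f^* c` is a combination of classes of algebraic cycles.
Verbatim the existential of the crux (`sectionalSource_iff`). [cite: Deligne2000, §1] -/
def IsSectionallyAlgebraic (n p : ℕ) (X : SchemeOver ℂ) (c : complexBetti X (2 * p)) : Prop :=
  ∃ (m : ℕ) (Y : SchemeOver ℂ) (f : Y ⟶ X) (s : Finset X.left.Opens),
    IsSmoothProjective m Y ∧ IsClosedImmersion f.left ∧ (∀ U ∈ s, IsAffineOpen U) ∧
      (⋃ U ∈ s, (U : Set X.left)) = (Set.range f.left.base)ᶜ ∧ 2 * p + s.card ≤ n ∧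
      Set.Nonempty (Set.range f.left.base)ᶜ ∧ complexBetti.map f (2 * p) c ∈ algebraicClasses Y p

/-- The crux is literally "every rational `(p,p)`-class below the middle is sectionally algebraic".
[cite: Deligne2000, §1] -/
theorem sectionalSource_iff :
    SectionalSource ↔
      ∀ ⦃n p : ℕ⦄ ⦃X : SchemeOver ℂ⦄, IsSmoothProjective n X → 2 * p + 1 ≤ n →
        ∀ c : complexBetti X (2 * p), IsRationalClass c → IsOfHodgeType n X (2 * p) p p c →
          IsSectionallyAlgebraic n p X c :=
  Iff.rfl

/-! ## The four stubs (two landed, two open) -/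

/-- **Stub 1 `stub_supply` — BERTINI SUPPLY OF AFFINE-COMPLEMENT HYPERSURFACE SECTIONS** (LANDED,
p149456): for `X` smooth projective of dimension `n ≥ 1` over `ℂ` there are a smooth projective `Y` of
dimension `n − 1`, a closed immersion `f : Y ⟶ X` and an AFFINE open `U ⊆ X` with `U = X ∖ f(Y)` non-empty.
[cite: Hartshorne1977, II Thm. 8.18, III Cor. 7.9 and II Prop. 2.5] [cite: VoisinHodgeII2003, §2.1.1] -/
theorem stub_supply :
    ∀ ⦃n : ℕ⦄ ⦃X : Literature.AlgebraicGeometry.Motives.SchemeOver ℂ⦄,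
      Literature.AlgebraicGeometry.Motives.IsSmoothProjective n X → 1 ≤ n →
      ∃ (Y : Literature.AlgebraicGeometry.Motives.SchemeOver ℂ) (f : Y ⟶ X) (U : X.left.Opens),
        Literature.AlgebraicGeometry.Motives.IsSmoothProjective (n - 1) Y ∧
          AlgebraicGeometry.IsClosedImmersion f.left ∧ AlgebraicGeometry.IsAffineOpen U ∧
          (U : Set X.left) = (Set.range f.left.base)ᶜ ∧ Set.Nonempty (Set.range f.left.base)ᶜ :=
  -- LANDED (p149456): `Theorems/AmpleAdicLefschetzSectionalSourceStubSupply.lean`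
  Summit.HodgeConjecture.HodgeConjecture.Theorems.stub_supply

/-- **Stub 2 `stub_lowDegree` — THE LOW-DEGREE CALIBRATION `p ≤ 1 ∨ n ≤ 4`** (LANDED, p150627): granted
SUPPLY, the crux holds at every `(n, p)` with `2p + 1 ≤ n` and `p ≤ 1 ∨ n ≤ 4` (Lefschetz `(1,1)` /
HC in dimension ≤ 3 on the supplied section). [cite: VoisinHodgeI2002, Thm. 11.30]
[cite: VoisinHodgeII2003, proof of Prop. 10.26] [cite: Deligne2000, §1] -/
theorem stub_lowDegree :
    (∀ ⦃n : ℕ⦄ ⦃X : Literature.AlgebraicGeometry.Motives.SchemeOver ℂ⦄,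
        Literature.AlgebraicGeometry.Motives.IsSmoothProjective n X → 1 ≤ n →
        ∃ (Y : Literature.AlgebraicGeometry.Motives.SchemeOver ℂ) (f : Y ⟶ X) (U : X.left.Opens),
          Literature.AlgebraicGeometry.Motives.IsSmoothProjective (n - 1) Y ∧
            AlgebraicGeometry.IsClosedImmersion f.left ∧ AlgebraicGeometry.IsAffineOpen U ∧
            (U : Set X.left) = (Set.range f.left.base)ᶜ ∧ Set.Nonempty (Set.range f.left.base)ᶜ) →
    ∀ ⦃n p : ℕ⦄ ⦃X : Literature.AlgebraicGeometry.Motives.SchemeOver ℂ⦄,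
      Literature.AlgebraicGeometry.Motives.IsSmoothProjective n X → 2 * p + 1 ≤ n → (p ≤ 1 ∨ n ≤ 4) →
      ∀ c : Literature.AlgebraicGeometry.HodgeTheory.complexBetti X (2 * p),
        Literature.AlgebraicGeometry.HodgeTheory.IsRationalClass c →
        Literature.AlgebraicGeometry.HodgeTheory.IsOfHodgeType n X (2 * p) p p c →
        ∃ (m : ℕ) (Y : Literature.AlgebraicGeometry.Motives.SchemeOver ℂ) (f : Y ⟶ X)
          (s : Finset X.left.Opens),
          Literature.AlgebraicGeometry.Motives.IsSmoothProjective m Y ∧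
            AlgebraicGeometry.IsClosedImmersion f.left ∧ (∀ U ∈ s, AlgebraicGeometry.IsAffineOpen U) ∧
            (⋃ U ∈ s, (U : Set X.left)) = (Set.range f.left.base)ᶜ ∧ 2 * p + s.card ≤ n ∧
            Set.Nonempty (Set.range f.left.base)ᶜ ∧
            Literature.AlgebraicGeometry.HodgeTheory.complexBetti.map f (2 * p) c ∈
              Literature.AlgebraicGeometry.HodgeTheory.algebraicClasses Y p :=
  -- LANDED (p150627): `Theorems/AmpleAdicLefschetzSectionalSourceStubLowDegree.lean`
  Summit.HodgeConjecture.HodgeConjecture.Theorems.stub_lowDegree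

/-- **Stub 3 `stub_iteratedSupply` — ITERATED BERTINI SUPPLY: SMOOTH LINEAR SECTIONS OF ANY CODIMENSION
WITH AMBIENT AFFINE COMPLEMENT PIECES** (LANDED, p153594). For `X` smooth projective of dimension `n` over `ℂ` and
`1 ≤ k ≤ n − 1` there are a smooth projective `Y` of dimension `n − k`, a closed immersion `f : Y ⟶ X` with
`X ∖ f(Y)` non-empty, and a set `s` of at most `k` AFFINE opens of `X` covering exactly `X ∖ f(Y)`. Why
true: iterate the pencil step of `stub_supply` along the composite embeddings `Yᵢ ↪ X ↪ ℙᴺ` (each `Yᵢ`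
smooth projective of dimension `n − i ≥ 2`, so Bertini + connectedness apply), `Y = X ∩ V(ℓ₁) ∩ ⋯ ∩ V(ℓ_k)`
set-theoretically, and `X ∖ Y = ⋃ᵢ X ∩ D(ℓᵢ)` with `X ∩ D(ℓᵢ) = ι⁻¹ D₊(ℓᵢ)` affine (closed in the affine
`D₊(ℓᵢ)`). Size M (induction on `k` with the invariant "the affine pieces are ambient basic opens
`Resolution.LinSec.XL (ιPP ι) v`", using the landed `range_fiberι_blowDown_base_eq_hyp`,
`exists_goodPencil`, `isClosedImmersion_fiberι_blowDown_left`, `Resolution.LinSec.isAffineOpen_XL`).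
[cite: Hartshorne1977, II Thm. 8.18 and II Prop. 2.5] [cite: VoisinHodgeII2003, §2.1.1] -/
theorem stub_iteratedSupply :
    ∀ ⦃n k : ℕ⦄ ⦃X : Literature.AlgebraicGeometry.Motives.SchemeOver ℂ⦄,
      Literature.AlgebraicGeometry.Motives.IsSmoothProjective n X → 1 ≤ k → k + 1 ≤ n →
      ∃ (Y : Literature.AlgebraicGeometry.Motives.SchemeOver ℂ) (f : Y ⟶ X) (s : Finset X.left.Opens),
        Literature.AlgebraicGeometry.Motives.IsSmoothProjective (n - k) Y ∧
          AlgebraicGeometry.IsClosedImmersion f.left ∧ (∀ U ∈ s, AlgebraicGeometry.IsAffineOpen U) ∧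
          (⋃ U ∈ s, (U : Set X.left)) = (Set.range f.left.base)ᶜ ∧ s.card ≤ k ∧
          Set.Nonempty (Set.range f.left.base)ᶜ :=
  -- LANDED (p153594): `Theorems/AmpleAdicLefschetzSectionalSourceStubIteratedSupply.lean`
  Summit.HodgeConjecture.HodgeConjecture.Theorems.stub_iteratedSupply

/-- **Stub 4 `stub_hodgeMiddle` — THE HODGE CONJECTURE IN THE MIDDLE DEGREE, `p ≥ 2`.** Every rational
`(p,p)`-class `c₀ ∈ H²ᵖ(X₀(ℂ); ℂ)` on every smooth projective complex variety `X₀` of dimension `2p`,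
`p ≥ 2`, is algebraic. Why plausibly true: it is an instance of the Hodge conjecture (Deligne 2000, §1);
why it is the right stub: by the lead's `Cruxes/SectionalSource/Hardness.lean`
(`hodge_middle_of_sectionalSource`) the crux IMPLIES it, and by `SectionalSource_of` below it implies
the crux, so it is EXACTLY the open content of `SectionalSource` (the cases `p ≤ 1` being Lefschetz `(1,1)`
and `algebraicClasses_zero`, inside `stub_lowDegree`). Open-problem grade; first instance `p = 2`: rational
`(2,2)`-classes on smooth projective fourfolds (known for uniruled / cubic / Fermat / certain abelian
fourfolds: Conte–Murre, Zucker, Shioda, Markman). [cite: Deligne2000, §1]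
[cite: VoisinHodgeII2003, §3.3 Thm. 3.33] -/
theorem stub_hodgeMiddle :
    ∀ ⦃p : ℕ⦄ ⦃X₀ : Literature.AlgebraicGeometry.Motives.SchemeOver ℂ⦄,
      Literature.AlgebraicGeometry.Motives.IsSmoothProjective (2 * p) X₀ → 2 ≤ p →
      ∀ c₀ : Literature.AlgebraicGeometry.HodgeTheory.complexBetti X₀ (2 * p),
        Literature.AlgebraicGeometry.HodgeTheory.IsRationalClass c₀ →
        Literature.AlgebraicGeometry.HodgeTheory.IsOfHodgeType (2 * p) X₀ (2 * p) p p c₀ →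
        c₀ ∈ Literature.AlgebraicGeometry.HodgeTheory.algebraicClasses X₀ p := by
  sorry

/-! ## Sorry-free glue -/

/-- **A closed immersion of smooth projective varieties of different dimensions is not surjective**
(else it is a homeomorphism and the dimensions agree, `eq_of_isSmoothProjective_of_isHomeomorph`).
[cite: Hartshorne1977, II Ex. 3.20] -/
theorem nonempty_compl_range_of_ne {m n : ℕ} {X Y : SchemeOver ℂ} (hY : IsSmoothProjective m Y)
    (hX : IsSmoothProjective n X) (f : Y ⟶ X) [hf : IsClosedImmersion f.left] (hmn : m ≠ n) :
    Set.Nonempty (Set.range f.left.base)ᶜ := by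
  rw [Set.nonempty_compl]
  intro huniv
  exact hmn (eq_of_isSmoothProjective_of_isHomeomorph hY hX f
    ((isHomeomorph_iff_isEmbedding_surjective).2
      ⟨f.left.isClosedEmbedding.isEmbedding, Set.range_eq_univ.1 huniv⟩))

/-! ## The composition with explicit hypotheses, and the skeleton theorem -/

/-- **THE COMPOSITION `supply → lowDegree → iteratedSupply → hodgeMiddle → SectionalSource`**
(sorry-free; hypotheses verbatim the four stub signatures). Given a rational `(p,p)`-class `c` on the
smooth projective `n`-fold `X` with `2p + 1 ≤ n`: if `p ≤ 1 ∨ n ≤ 4`, LOWDEGREE (fed with SUPPLY) gives the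
witness. Otherwise `p ≥ 2`; put `k := n − 2p ≥ 1`; ITERATEDSUPPLY gives a smooth projective `Y` of
dimension `n − k = 2p`, a closed immersion `f : Y ⟶ X` with non-empty complement covered by `≤ k` affine
opens (so `2p + |s| ≤ n`); `f^* c` is rational (`IsRationalClass.map`) and of Hodge type `(p,p)` on `Y`
(`IsOfHodgeType.map_of_le`, `2p ≤ n`, Hodge models by `nonempty_hodgeModel_holds`), a class in the MIDDLE
degree of `Y`, hence algebraic by HODGEMIDDLE. [cite: Deligne2000, §1] [cite: VoisinHodgeI2002, §7.3.2] -/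
theorem SectionalSource_of
    (hSup : ∀ ⦃n : ℕ⦄ ⦃X : Literature.AlgebraicGeometry.Motives.SchemeOver ℂ⦄,
      Literature.AlgebraicGeometry.Motives.IsSmoothProjective n X → 1 ≤ n →
      ∃ (Y : Literature.AlgebraicGeometry.Motives.SchemeOver ℂ) (f : Y ⟶ X) (U : X.left.Opens),
        Literature.AlgebraicGeometry.Motives.IsSmoothProjective (n - 1) Y ∧
          AlgebraicGeometry.IsClosedImmersion f.left ∧ AlgebraicGeometry.IsAffineOpen U ∧
          (U : Set X.left) = (Set.range f.left.base)ᶜ ∧ Set.Nonempty (Set.range f.left.base)ᶜ)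
    (hLow : (∀ ⦃n : ℕ⦄ ⦃X : Literature.AlgebraicGeometry.Motives.SchemeOver ℂ⦄,
        Literature.AlgebraicGeometry.Motives.IsSmoothProjective n X → 1 ≤ n →
        ∃ (Y : Literature.AlgebraicGeometry.Motives.SchemeOver ℂ) (f : Y ⟶ X) (U : X.left.Opens),
          Literature.AlgebraicGeometry.Motives.IsSmoothProjective (n - 1) Y ∧
            AlgebraicGeometry.IsClosedImmersion f.left ∧ AlgebraicGeometry.IsAffineOpen U ∧
            (U : Set X.left) = (Set.range f.left.base)ᶜ ∧ Set.Nonempty (Set.range f.left.base)ᶜ) →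
      ∀ ⦃n p : ℕ⦄ ⦃X : Literature.AlgebraicGeometry.Motives.SchemeOver ℂ⦄,
      Literature.AlgebraicGeometry.Motives.IsSmoothProjective n X → 2 * p + 1 ≤ n → (p ≤ 1 ∨ n ≤ 4) →
      ∀ c : Literature.AlgebraicGeometry.HodgeTheory.complexBetti X (2 * p),
        Literature.AlgebraicGeometry.HodgeTheory.IsRationalClass c →
        Literature.AlgebraicGeometry.HodgeTheory.IsOfHodgeType n X (2 * p) p p c →
        ∃ (m : ℕ) (Y : Literature.AlgebraicGeometry.Motives.SchemeOver ℂ) (f : Y ⟶ X)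
          (s : Finset X.left.Opens),
          Literature.AlgebraicGeometry.Motives.IsSmoothProjective m Y ∧
            AlgebraicGeometry.IsClosedImmersion f.left ∧ (∀ U ∈ s, AlgebraicGeometry.IsAffineOpen U) ∧
            (⋃ U ∈ s, (U : Set X.left)) = (Set.range f.left.base)ᶜ ∧ 2 * p + s.card ≤ n ∧
            Set.Nonempty (Set.range f.left.base)ᶜ ∧
            Literature.AlgebraicGeometry.HodgeTheory.complexBetti.map f (2 * p) c ∈
              Literature.AlgebraicGeometry.HodgeTheory.algebraicClasses Y p)
    (hIter : ∀ ⦃n k : ℕ⦄ ⦃X : Literature.AlgebraicGeometry.Motives.SchemeOver ℂ⦄,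
      Literature.AlgebraicGeometry.Motives.IsSmoothProjective n X → 1 ≤ k → k + 1 ≤ n →
      ∃ (Y : Literature.AlgebraicGeometry.Motives.SchemeOver ℂ) (f : Y ⟶ X) (s : Finset X.left.Opens),
        Literature.AlgebraicGeometry.Motives.IsSmoothProjective (n - k) Y ∧
          AlgebraicGeometry.IsClosedImmersion f.left ∧ (∀ U ∈ s, AlgebraicGeometry.IsAffineOpen U) ∧
          (⋃ U ∈ s, (U : Set X.left)) = (Set.range f.left.base)ᶜ ∧ s.card ≤ k ∧
          Set.Nonempty (Set.range f.left.base)ᶜ)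
    (hMid : ∀ ⦃p : ℕ⦄ ⦃X₀ : Literature.AlgebraicGeometry.Motives.SchemeOver ℂ⦄,
      Literature.AlgebraicGeometry.Motives.IsSmoothProjective (2 * p) X₀ → 2 ≤ p →
      ∀ c₀ : Literature.AlgebraicGeometry.HodgeTheory.complexBetti X₀ (2 * p),
        Literature.AlgebraicGeometry.HodgeTheory.IsRationalClass c₀ →
        Literature.AlgebraicGeometry.HodgeTheory.IsOfHodgeType (2 * p) X₀ (2 * p) p p c₀ →
        c₀ ∈ Literature.AlgebraicGeometry.HodgeTheory.algebraicClasses X₀ p) :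
    Summit.HodgeConjecture.HodgeConjecture.Theses.AmpleAdicLefschetz.SectionalSource := by
  intro n p X hX hp c hc hh
  by_cases hlow : p ≤ 1 ∨ n ≤ 4
  · -- the low-degree range: the calibration stub, fed with SUPPLY
    exact hLow hSup hX hp hlow c hc hh
  · -- `p ≥ 2`: cut down to dimension exactly `2p` and apply HC in the middle degree of the section
    have hp2 : 2 ≤ p := by omega
    obtain ⟨Y, f, s, hY, hf, hs, hcov, hcard, hne⟩ :=
      hIter hX (show 1 ≤ n - 2 * p by omega) (show n - 2 * p + 1 ≤ n by omega)
    have hdim : n - (n - 2 * p) = 2 * p := by omega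
    rw [hdim] at hY
    haveI := hf
    refine ⟨2 * p, Y, f, s, hY, hf, hs, hcov, by omega, hne, ?_⟩
    obtain ⟨B⟩ := (nonempty_hodgeModel_holds (n := 2 * p) (X := Y)) hY
    have hrat : IsRationalClass (complexBetti.map f (2 * p) c) :=
      hc.map (AlgPoints.mapContinuous (L := ℂ) f)
    have hhdg : IsOfHodgeType (2 * p) Y (2 * p) p p (complexBetti.map f (2 * p) c) :=
      hh.map_of_le hY hX B f (by omega)
    exact hMid hY hp2 _ hrat hhdg

/-- **THE SKELETON THEOREM.** The crux
`Summit.HodgeConjecture.HodgeConjecture.Theses.AmpleAdicLefschetz.SectionalSource`, concluded BY NAME from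
the four DECLARED stubs (three landed, one `sorry`) through the sorry-free composition `SectionalSource_of`.
[cite: Deligne2000, §1] -/
theorem SectionalSource_of_stubs :
    Summit.HodgeConjecture.HodgeConjecture.Theses.AmpleAdicLefschetz.SectionalSource :=
  SectionalSource_of stub_supply stub_lowDegree stub_iteratedSupply stub_hodgeMiddle

/-! ## Sorry-free sanity: the position of the stubs -/

/-- `stub_iteratedSupply` at `k = 1` is `stub_supply` for `n ≥ 2` (the stub generalises the landed one;
conversely it is proved from the landed one's pencil step by iteration). [folklore] -/
theorem supply_of_iteratedSupply
    (hIter : ∀ ⦃n k : ℕ⦄ ⦃X : SchemeOver ℂ⦄, IsSmoothProjective n X → 1 ≤ k → k + 1 ≤ n →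
      ∃ (Y : SchemeOver ℂ) (f : Y ⟶ X) (s : Finset X.left.Opens),
        IsSmoothProjective (n - k) Y ∧ IsClosedImmersion f.left ∧ (∀ U ∈ s, IsAffineOpen U) ∧
          (⋃ U ∈ s, (U : Set X.left)) = (Set.range f.left.base)ᶜ ∧ s.card ≤ k ∧
          Set.Nonempty (Set.range f.left.base)ᶜ)
    ⦃n : ℕ⦄ ⦃X : SchemeOver ℂ⦄ (hX : IsSmoothProjective n X) (hn : 2 ≤ n) :
    ∃ (Y : SchemeOver ℂ) (f : Y ⟶ X) (s : Finset X.left.Opens),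
      IsSmoothProjective (n - 1) Y ∧ IsClosedImmersion f.left ∧ (∀ U ∈ s, IsAffineOpen U) ∧
        (⋃ U ∈ s, (U : Set X.left)) = (Set.range f.left.base)ᶜ ∧ s.card ≤ 1 ∧
        Set.Nonempty (Set.range f.left.base)ᶜ :=
  hIter hX le_rfl hn

/-- **The Hodge conjecture (cycle part, all degrees) implies `stub_hodgeMiddle`** — the open stub is a
fragment of the summit, as a piece of a crux must be; the converse containment (crux ⇒ stub) is
`Cruxes/SectionalSource/Hardness.lean`. [cite: Deligne2000, §1] -/
theorem hodgeMiddle_of_hodge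
    (hHC : ∀ ⦃n p : ℕ⦄ ⦃X : SchemeOver ℂ⦄, IsSmoothProjective n X →
      ∀ c : complexBetti X (2 * p), IsRationalClass c → IsOfHodgeType n X (2 * p) p p c →
        c ∈ algebraicClasses X p)
    ⦃p : ℕ⦄ ⦃X₀ : SchemeOver ℂ⦄ (hX₀ : IsSmoothProjective (2 * p) X₀) (_hp : 2 ≤ p)
    (c₀ : complexBetti X₀ (2 * p)) (hc : IsRationalClass c₀) (hh : IsOfHodgeType (2 * p) X₀ (2 * p) p p c₀) :
    c₀ ∈ algebraicClasses X₀ p :=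
  hHC hX₀ c₀ hc hh

end Summit.HodgeConjecture.HodgeConjecture.Cruxes.SectionalSource.Birth

end
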